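import Mathlib.Analysis.SpecialFunctions.Trigonometric.Basic
import Literature.Analysis.ValidatedNumerics.IntervalPolynomial
import HarnessLib

/-!
# RiemannHypothesis / GroundBarta machinery — PHANTOM LEVEL CERTIFICATES (1/2): kernel-checkable lower bounds for cosine polynomials `Σ_j c_j cos(jθ)`

RiemannHypothesis / GroundBarta machinery (helper file, `--supports stmt-RiemannHypothesis-18085`; seat rh-explicit-weil-6, memo
`run/shared/lean/pub/rh-explicit/WEIL6-APRIME.md`); namespace `…Theorems.EvenWinsBeyondArch.CosPoly`.
A thin, problem-independent layer on top of the validated-numerics sign checker `PolyMP.posOn`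
(`IntervalPolynomial.lean`: interval Taylor shift + absolute tail bound + bisection, soundness
`PolyMP.posOn_sound`): a cosine polynomial with INTEGER coefficients `f(θ) = Σ_{j<n} c_j cos(jθ)` is
rewritten exactly as `p(cos θ)` with `p = Σ_j c_j T_j ∈ ℤ[x]` (Chebyshev polynomials of the first kind,
computed as coefficient LISTS by the three-term recurrence so that the kernel can evaluate them), and
`p > 0` on `[-1, 1]` is decided by `posOn`.  Everything is computable over `ℤ`; the real side is the
Horner shadow `PolyMP.evalR`.

* `chebPair n = (T_n, T_{n+1})` as integer coefficient lists, `chebT n`, and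
  `evalR_chebT_cos : evalR (realOf (chebT n)) (cos θ) = cos (n θ)`;
* `cosPolyZ cs j` = the list of `Σ_i cs[i] · T_{j+i}`, `cosSumFrom cs j θ = Σ_i cs[i] cos((j+i)θ)`, and
  `evalR_cosPolyZ_cos`;
* the checker `check S d cs` (`posOn` at scale `S`, bisection depth `d`, on `[-1, 1]`) and its soundness
  **`cosSumFrom_pos_of_check`**: `check S d cs = true → ∀ θ, 0 < Σ_i cs[i] cos(iθ)`;
* `cosSumFrom_zero_eq_sum`: the same sum written over `Finset.range`.

Typical use (one-sided trigonometric approximation à la Fejér / Egerváry–Szász, e.g. the tail LEVEL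
CERTIFICATES of phantom-rippled Weil weights): to certify `Σ_j a_j cos(jθ) ≥ -m` for dyadic `a_j, m`,
scale to integers and run `check` on `m·2^K :: (a_j·2^K)_j`.  No facts, no axioms.

## References
* L. Fejér, *Über trigonometrische Polynome*, J. reine angew. Math. 146 (1916), 53–82 (nonnegative
  cosine polynomials). [folklore]
* R. E. Moore, *Interval Analysis*, Prentice-Hall 1966, Ch. 3 (the branch-and-bound behind `posOn`).
  [folklore]
-/

set_option linter.dupNamespace false

namespace Summit.RiemannHypothesis.RiemannHypothesis.Theorems.EvenWinsBeyondArch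

open Literature.Analysis.ValidatedNumerics

namespace CosPoly

open PolyMP (evalR IPoly PMem posOn)
open NumericsMP

/-! ## Integer coefficient lists and their real shadows -/

/-- The real coefficient list of an integer coefficient list. [folklore] -/
noncomputable def realOf (cs : List ℤ) : List ℝ := cs.map fun c => (c : ℝ)

/-- [folklore] -/
@[simp] theorem realOf_nil : realOf [] = [] := rfl

/-- [folklore] -/
@[simp] theorem realOf_cons (c : ℤ) (cs : List ℤ) : realOf (c :: cs) = (c : ℝ) :: realOf cs := rfl

/-- Coefficientwise sum of integer lists (shape of `PolyMP.addR`). [folklore] -/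
def addZ : List ℤ → List ℤ → List ℤ
  | [], bs => bs
  | a :: as, [] => a :: as
  | a :: as, b :: bs => (a + b) :: addZ as bs

/-- `addZ` evaluates to the sum. [folklore] -/
theorem evalR_realOf_addZ : ∀ (as bs : List ℤ) (x : ℝ),
    evalR (realOf (addZ as bs)) x = evalR (realOf as) x + evalR (realOf bs) x
  | [], bs, x => by simp [addZ]
  | a :: as, [], x => by simp [addZ]
  | a :: as, b :: bs, x => by
      simp only [addZ, realOf_cons, PolyMP.evalR_cons, evalR_realOf_addZ as bs x]
      push_cast
      ring

/-- Integer scalar multiple. [folklore] -/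
def smulZ (c : ℤ) (as : List ℤ) : List ℤ := as.map (c * ·)

/-- `smulZ` evaluates to the scalar multiple. [folklore] -/
theorem evalR_realOf_smulZ (c : ℤ) : ∀ (as : List ℤ) (x : ℝ),
    evalR (realOf (smulZ c as)) x = (c : ℝ) * evalR (realOf as) x
  | [], x => by simp [smulZ, realOf]
  | a :: as, x => by
      have ih := evalR_realOf_smulZ c as x
      simp only [smulZ] at ih
      simp only [smulZ, List.map_cons, realOf_cons, PolyMP.evalR_cons, ih]
      push_cast
      ring

/-- Multiplication by `2x`. [folklore] -/
def twoX (as : List ℤ) : List ℤ := 0 :: smulZ 2 as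

/-- `twoX` evaluates to `2x · p(x)`. [folklore] -/
theorem evalR_realOf_twoX (as : List ℤ) (x : ℝ) :
    evalR (realOf (twoX as)) x = 2 * x * evalR (realOf as) x := by
  rw [twoX, realOf_cons, PolyMP.evalR_cons, evalR_realOf_smulZ]
  push_cast
  ring

/-! ## Chebyshev polynomials of the first kind as integer lists -/

/-- `chebPair n = (T_n, T_{n+1})` by `T_{n+2} = 2x T_{n+1} − T_n`. [folklore] -/
def chebPair : ℕ → List ℤ × List ℤ
  | 0 => ([1], [0, 1])
  | n + 1 => ((chebPair n).2, addZ (twoX (chebPair n).2) (smulZ (-1) (chebPair n).1))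

/-- The Chebyshev polynomial `T_n` as an integer coefficient list. [folklore] -/
def chebT (n : ℕ) : List ℤ := (chebPair n).1

/-- `T_n(cos θ) = cos(nθ)` and `T_{n+1}(cos θ) = cos((n+1)θ)` for the list pair. [folklore] -/
theorem chebPair_cos (θ : ℝ) : ∀ n : ℕ,
    evalR (realOf (chebPair n).1) (Real.cos θ) = Real.cos (n * θ) ∧
      evalR (realOf (chebPair n).2) (Real.cos θ) = Real.cos ((n + 1) * θ)
  | 0 => by simp [chebPair, realOf]
  | n + 1 => by
      obtain ⟨h1, h2⟩ := chebPair_cos θ n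
      refine ⟨?_, ?_⟩
      · simp only [chebPair]
        rw [h2]
        push_cast
        ring_nf
      · simp only [chebPair]
        rw [evalR_realOf_addZ, evalR_realOf_twoX, evalR_realOf_smulZ, h1, h2]
        have e1 : ((n : ℝ) + 1 + 1) * θ = ((n : ℝ) + 1) * θ + θ := by ring
        have e2 : (n : ℝ) * θ = ((n : ℝ) + 1) * θ - θ := by ring
        push_cast
        rw [e1, Real.cos_add, e2, Real.cos_sub]
        ring

/-- **`T_n(cos θ) = cos(nθ)`** for the integer list `chebT n`. [folklore] -/
theorem evalR_chebT_cos (n : ℕ) (θ : ℝ) :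
    evalR (realOf (chebT n)) (Real.cos θ) = Real.cos (n * θ) :=
  (chebPair_cos θ n).1

/-! ## Cosine polynomials -/

/-- The Chebyshev expansion `Σ_i cs[i] · T_{j+i}` of a cosine coefficient list starting at harmonic `j`.
[folklore] -/
def cosPolyZ : List ℤ → ℕ → List ℤ
  | [], _ => []
  | c :: cs, j => addZ (smulZ c (chebT j)) (cosPolyZ cs (j + 1))

/-- The cosine sum `Σ_i cs[i] cos((j+i)θ)`. [folklore] -/
noncomputable def cosSumFrom : List ℤ → ℕ → ℝ → ℝ
  | [], _, _ => 0
  | c :: cs, j, θ => (c : ℝ) * Real.cos (j * θ) + cosSumFrom cs (j + 1) θ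

/-- **The Chebyshev expansion evaluates to the cosine sum at `x = cos θ`.** [folklore] -/
theorem evalR_cosPolyZ_cos (θ : ℝ) : ∀ (cs : List ℤ) (j : ℕ),
    evalR (realOf (cosPolyZ cs j)) (Real.cos θ) = cosSumFrom cs j θ
  | [], j => by simp [cosPolyZ, cosSumFrom, realOf]
  | c :: cs, j => by
      rw [cosPolyZ, evalR_realOf_addZ, evalR_realOf_smulZ, evalR_chebT_cos,
        evalR_cosPolyZ_cos θ cs (j + 1), cosSumFrom]

/-- The cosine sum from harmonic `0` as a `Finset.range` sum. [folklore] -/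
theorem cosSumFrom_eq_sum : ∀ (cs : List ℤ) (j : ℕ) (θ : ℝ),
    cosSumFrom cs j θ = ∑ i ∈ Finset.range cs.length, (cs.getD i 0 : ℝ) * Real.cos ((j + i : ℕ) * θ)
  | [], j, θ => by simp [cosSumFrom]
  | c :: cs, j, θ => by
      rw [cosSumFrom, cosSumFrom_eq_sum cs (j + 1) θ, List.length_cons, Finset.sum_range_succ']
      simp only [List.getD_cons_succ, List.getD_cons_zero, Nat.add_zero]
      rw [add_comm]
      congr 1
      exact Finset.sum_congr rfl fun i _ => by
        congr 2
        push_cast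
        ring

/-! ## The checker -/

/-- The integer coefficient list as an interval polynomial of THIN intervals at scale `S`. [folklore] -/
def intPoly (S : ℕ) (cs : List ℤ) : IPoly := cs.map (MI.ofInt S)

/-- The thin interval polynomial encloses the real list. [folklore] -/
theorem pmem_intPoly (S : ℕ) : ∀ cs : List ℤ, PMem S (realOf cs) (intPoly S cs)
  | [] => PolyMP.pmem_nil S
  | c :: cs => by
    simp only [realOf_cons, intPoly, List.map_cons]
    exact PolyMP.pmem_cons (MI.mem_ofInt S c) (pmem_intPoly S cs)

/-- **Checker**: scale `S > 0` and `posOn` (depth `d`) of the Chebyshev expansion on `[-1, 1]`. [folklore] -/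
def check (S d : ℕ) (cs : List ℤ) : Bool :=
  decide (0 < S) && posOn S d (intPoly S (cosPolyZ cs 0)) (-1) 1

/-- **Soundness**: a passing check proves `0 < Σ_i cs[i] cos(iθ)` for every real `θ`. [folklore] -/
theorem cosSumFrom_pos_of_check {S d : ℕ} {cs : List ℤ} (h : check S d cs = true) (θ : ℝ) :
    0 < cosSumFrom cs 0 θ := by
  simp only [check, Bool.and_eq_true, decide_eq_true_eq] at h
  obtain ⟨hS, hpos⟩ := h
  have hlo : ((-1 : ℚ) : ℝ) ≤ Real.cos θ := by exact_mod_cast Real.neg_one_le_cos θ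
  have hhi : Real.cos θ ≤ ((1 : ℚ) : ℝ) := by exact_mod_cast Real.cos_le_one θ
  have := PolyMP.posOn_sound hS hpos (by norm_num) (pmem_intPoly S (cosPolyZ cs 0)) hlo hhi
  rwa [evalR_cosPolyZ_cos] at this

/-- Soundness, `Finset.range` form: `0 < Σ_{i<|cs|} cs[i] cos(iθ)`. [folklore] -/
theorem sum_cos_pos_of_check {S d : ℕ} {cs : List ℤ} (h : check S d cs = true) (θ : ℝ) :
    0 < ∑ i ∈ Finset.range cs.length, (cs.getD i 0 : ℝ) * Real.cos (i * θ) := by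
  have := cosSumFrom_pos_of_check h θ
  rw [cosSumFrom_eq_sum] at this
  simpa using this

/-- A tiny sanity example: `3 + 2cos θ + cos 2θ > 0` (it equals `2 + 2cos θ + 2cos²θ ≥ 3/2`). [folklore] -/
example : check 64 4 [3, 2, 1] = true := by decide +kernel

end CosPoly

end Summit.RiemannHypothesis.RiemannHypothesis.Theorems.EvenWinsBeyondArch
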